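import Mathlib
import Summits.Ventures.HodgeRepro2.T5DegreeOneEmbeddings
import Summits.Ventures.HodgeRepro2.T5SplitsCompletely

/-!
# T5EmbeddingPrimeEquiv — embeddings `F → ℚ_p` ARE the degree-one primes above `p`

Tier-5 support (seat p7, cell pub-hodge-repro2), second file of the embedding chain, for
route/T5-CHECK-G-p7.md §12.2 row P1.5 («the p-adic places induced by elements in Σ via ι_p») and
T5-LEAN-p7.md §22 (b)(iii).  `T5DegreeOneEmbeddings` built the two maps
`w ↦ embedding w` (degree-one prime ↦ `F →+* ℚ_[p]`) and `φ ↦ inducedPrime φ`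
(`F →+* ℚ_[p]` ↦ degree-one prime); this file shows they are INVERSE to each other:

* `restrict_eq_toPadicInt`: on `𝓞 F`, `φ` IS the chain's `toPadicInt` of its induced prime — both
  maps `𝓞 F → ℤ_p → ℤ/pⁿ` kill `(inducedIdeal φ)ⁿ`, hence factor through
  `𝓞 F ⧸ (inducedIdeal φ)ⁿ ≃+* ℤ/pⁿ` (row 49), and two ring homomorphisms out of `ℤ/pⁿ` agree
  (`RingHom.ext_zmod`); `ℤ_p = lim ℤ/pⁿ` (`PadicInt.ext_of_toZModPow`) finishes;
* `embedding_inducedPrime`, `inducedPrime_embedding`, `embeddingEquiv : (F →+* ℚ_[p]) ≃ DegreeOnePrime F p`;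
* consequences: `inducedPrime_injective` (distinct embeddings induce distinct places),
  `disjoint_image_inducedPrime` (disjoint Σ, Σc ⇒ disjoint place sets — the printed sentence of
  P1.5), `card_ringHom_eq_finrank` (`#Hom(F, ℚ_p) = [F : ℚ]` when `p` splits completely, from the
  fundamental identity `Σ e·f = [F : ℚ]`), and its Galois form `card_ringHom_eq_finrank_of_isGalois`
  (one degree-one prime above `p` suffices, row 12's `degree_one_of_isGalois`).

Nothing about CM types or Hecke characters is asserted.
-/

namespace Summit.Ventures.HodgeRepro2.T5EmbeddingPrimeEquiv

open IsDedekindDomain NumberField T5DegreeOneEmbeddings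

variable {F : Type*} [Field F] {p : ℕ} [hp : Fact p.Prime]

section identification

variable [NumberField F] (φ : F →+* ℚ_[p])

/-- THE IDENTIFICATION: on the integers, `restrict φ` IS the chain's `toPadicInt` of the induced
prime (row 50) — both maps `𝓞 F → ℤ_p → ℤ/pⁿ` kill `(inducedIdeal φ)ⁿ`, hence factor through
`𝓞 F ⧸ (inducedIdeal φ)ⁿ ≃+* ℤ/pⁿ` (row 49), and two ring homomorphisms out of `ℤ/pⁿ` agree. -/
theorem restrict_eq_toPadicInt :
    restrict φ = T5DegreeOnePadicInt.toPadicInt (inducedIdeal_ne_bot φ)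
      (natCast_mem_inducedIdeal φ) (natCast_notMem_inducedIdeal_sq φ)
      (exists_int_sub_mem_inducedIdeal φ) := by
  ext x
  rw [← PadicInt.ext_of_toZModPow]
  intro n
  rw [T5DegreeOnePadicInt.toZModPow_toPadicInt]
  set I := inducedIdeal φ with hI
  set g₁ : 𝓞 F →+* ZMod (p ^ n) := (PadicInt.toZModPow n).comp (restrict φ) with hg₁
  set g₂ : 𝓞 F →+* ZMod (p ^ n) := T5DegreeOnePadicInt.toZModPowHom (inducedIdeal_ne_bot φ)
    (natCast_mem_inducedIdeal φ) (natCast_notMem_inducedIdeal_sq φ)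
    (exists_int_sub_mem_inducedIdeal φ) n with hg₂
  have h₁ : ∀ a ∈ I ^ n, g₁ a = 0 := by
    intro a ha
    rw [hg₁, RingHom.comp_apply, ← RingHom.mem_ker, PadicInt.ker_toZModPow]
    exact restrict_mem_span_pow_of_mem_pow φ n a ha
  have h₂ : ∀ a ∈ I ^ n, g₂ a = 0 := fun a ha =>
    (T5DegreeOnePadicInt.toZModPowHom_eq_zero_iff _ _ _ _ n a).mpr ha
  set q := T5DegreeOneQuotient.quotPowEquivZMod (inducedIdeal_ne_bot φ)
    (natCast_mem_inducedIdeal φ) (natCast_notMem_inducedIdeal_sq φ)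
    (exists_int_sub_mem_inducedIdeal φ) n with hq
  set ĝ₁ := Ideal.Quotient.lift (I ^ n) g₁ h₁ with hĝ₁
  set ĝ₂ := Ideal.Quotient.lift (I ^ n) g₂ h₂ with hĝ₂
  have key := RingHom.ext_zmod (ĝ₁.comp q.symm.toRingHom) (ĝ₂.comp q.symm.toRingHom)
  have := RingHom.congr_fun key (q (Ideal.Quotient.mk (I ^ n) x))
  simpa [hĝ₁, hĝ₂, Ideal.Quotient.lift_mk, hg₁, hg₂] using this

/-- The embedding attached to the prime induced by `φ` is `φ` itself. -/
theorem embedding_inducedPrime :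
    embedding (inducedPrime φ) p (degree_one_inducedPrime φ) = φ := by
  apply IsFractionRing.ringHom_ext (A := 𝓞 F)
  intro x
  have h := congrArg (fun g : 𝓞 F →+* ℤ_[p] => (g x : ℚ_[p])) (restrict_eq_toPadicInt φ)
  simp only [coe_restrict] at h
  rw [embedding_algebraMap]
  exact h.symm

/-- The prime induced by the embedding attached to `w` is `w` itself. -/
theorem inducedPrime_embedding (w : HeightOneSpectrum (𝓞 F))
    [hw : w.asIdeal.LiesOver (Ideal.span {(p : ℤ)})]
    (hdeg : w.asIdeal.ramificationIdx ℤ * w.asIdeal.inertiaDeg ℤ = 1) :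
    inducedPrime (embedding w p hdeg) = w := by
  apply HeightOneSpectrum.ext
  ext x
  rw [inducedPrime_asIdeal, mem_inducedIdeal_iff, norm_embedding_algebraMap_lt_one_iff p w hdeg]

end identification

section equiv

variable (F) (p) [NumberField F]

/-- The degree-one primes of `F` above `p`. -/
def DegreeOnePrime : Type _ :=
  {w : HeightOneSpectrum (𝓞 F) // w.asIdeal.LiesOver (Ideal.span {(p : ℤ)}) ∧
    w.asIdeal.ramificationIdx ℤ * w.asIdeal.inertiaDeg ℤ = 1}

/-- **Embeddings ↔ degree-one primes**: `F →+* ℚ_[p]` is in bijection with the degree-one primes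
of `F` above `p`, `φ ↦ {x | ‖φ x‖ < 1}` with inverse `w ↦ (F ⊆ F_w ≃ ℚ_p)`. -/
noncomputable def embeddingEquiv : (F →+* ℚ_[p]) ≃ DegreeOnePrime F p where
  toFun φ := ⟨inducedPrime φ, inducedPrime_liesOver φ, degree_one_inducedPrime φ⟩
  invFun w := haveI := w.2.1; embedding w.1 p w.2.2
  left_inv φ := embedding_inducedPrime φ
  right_inv w := by
    haveI := w.2.1
    exact Subtype.ext (inducedPrime_embedding w.1 w.2.2)

/-- `embeddingEquiv φ` is the induced prime. -/
theorem embeddingEquiv_apply (φ : F →+* ℚ_[p]) :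
    (embeddingEquiv F p φ).1 = inducedPrime φ := rfl

/-- `embeddingEquiv.symm w` is the embedding attached to `w`. -/
theorem embeddingEquiv_symm_apply (w : DegreeOnePrime F p) :
    (embeddingEquiv F p).symm w = haveI := w.2.1; embedding w.1 p w.2.2 := rfl

/-- The number of embeddings `F → ℚ_p` is the number of degree-one primes above `p`. -/
theorem card_ringHom_eq_card_degreeOnePrime :
    Nat.card (F →+* ℚ_[p]) = Nat.card (DegreeOnePrime F p) :=
  Nat.card_congr (embeddingEquiv F p)

/-- If every prime of `F` above `p` has degree one («p splits completely»), the degree-one primes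
are all the primes above `p`. -/
noncomputable def degreeOnePrimeEquivPrimesOver
    (hsplit : ∀ w : HeightOneSpectrum (𝓞 F), w.asIdeal.LiesOver (Ideal.span {(p : ℤ)}) →
      w.asIdeal.ramificationIdx ℤ * w.asIdeal.inertiaDeg ℤ = 1) :
    DegreeOnePrime F p ≃ (Ideal.span {(p : ℤ)}).primesOver (𝓞 F) where
  toFun w := ⟨w.1.asIdeal, w.1.isPrime, w.2.1⟩
  invFun P := ⟨⟨P.1, P.2.1, by
      intro h
      have hmem : (p : 𝓞 F) ∈ P.1 :=
        haveI := P.2.2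
        T5DegreeOneQuotient.natCast_mem_of_liesOver
      rw [h, Ideal.mem_bot] at hmem
      exact hp.out.ne_zero (by exact_mod_cast hmem)⟩,
    P.2.2, hsplit _ P.2.2⟩
  left_inv w := rfl
  right_inv P := rfl

/-- «p splits completely» ⇒ the embeddings `F → ℚ_p` are counted by the primes above `p`. -/
theorem card_ringHom_eq_ncard_primesOver
    (hsplit : ∀ w : HeightOneSpectrum (𝓞 F), w.asIdeal.LiesOver (Ideal.span {(p : ℤ)}) →
      w.asIdeal.ramificationIdx ℤ * w.asIdeal.inertiaDeg ℤ = 1) :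
    Nat.card (F →+* ℚ_[p]) = ((Ideal.span {(p : ℤ)}).primesOver (𝓞 F)).ncard := by
  rw [card_ringHom_eq_card_degreeOnePrime, Nat.card_congr (degreeOnePrimeEquivPrimesOver F p hsplit),
    Nat.card_coe_set_eq]

end equiv

section injective

variable [NumberField F]

/-- The induced prime determines the embedding: `inducedPrime` is injective. -/
theorem inducedPrime_injective :
    Function.Injective (inducedPrime : (F →+* ℚ_[p]) → HeightOneSpectrum (𝓞 F)) :=
  fun _ _ h => (embeddingEquiv F p).injective (Subtype.ext h)

/-- Distinct embeddings `F → ℚ_p` induce distinct primes (CHECK-G §12.2 row P1.5, in the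
embedding vocabulary: «the p-adic places induced by distinct elements of Σ are distinct»). -/
theorem inducedPrime_ne_of_ne {φ₁ φ₂ : F →+* ℚ_[p]} (h : φ₁ ≠ φ₂) :
    inducedPrime φ₁ ≠ inducedPrime φ₂ :=
  fun heq => h (inducedPrime_injective heq)

/-- Disjoint sets of embeddings induce disjoint sets of primes (the sentence «the p-adic places
induced by elements in Σ via ι_p are disjoint from those induced by elements in Σc», for any two
disjoint sets Σ, Σc of embeddings `F → ℚ_p`). -/
theorem disjoint_image_inducedPrime {T T' : Set (F →+* ℚ_[p])} (h : Disjoint T T') :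
    Disjoint (inducedPrime '' T) (inducedPrime '' T') :=
  (Set.disjoint_image_iff inducedPrime_injective).mpr h

end injective

section count

variable (F) (p) [NumberField F]

/-- «p splits completely» ⇒ the number of primes above `p` is `[F : ℚ]` (the fundamental identity
`Σ e·f = [F : ℚ]` with every term equal to one). -/
theorem ncard_primesOver_eq_finrank
    (hsplit : ∀ w : HeightOneSpectrum (𝓞 F), w.asIdeal.LiesOver (Ideal.span {(p : ℤ)}) →
      w.asIdeal.ramificationIdx ℤ * w.asIdeal.inertiaDeg ℤ = 1) :
    ((Ideal.span {(p : ℤ)}).primesOver (𝓞 F)).ncard = Module.finrank ℚ F := by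
  haveI : (Ideal.span {(p : ℤ)}).IsMaximal := isMaximal_span_p
  have hsum := Ideal.sum_ramification_inertia (𝓞 F) ℚ F (p := Ideal.span {(p : ℤ)}) span_p_ne_bot
  rw [← IsDedekindDomain.coe_primesOverFinset span_p_ne_bot (𝓞 F), Set.ncard_coe_finset, ← hsum]
  symm
  rw [← Nat.mul_one (Finset.card _)]
  apply Finset.sum_const_nat
  intro P hP
  have hP' := (IsDedekindDomain.mem_primesOverFinset_iff span_p_ne_bot (𝓞 F)).mp hP
  haveI : P.IsPrime := hP'.1
  haveI : P.LiesOver (Ideal.span {(p : ℤ)}) := hP'.2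
  have hne : P ≠ ⊥ := by
    intro h
    have hmem : (p : 𝓞 F) ∈ P := T5DegreeOneQuotient.natCast_mem_of_liesOver
    rw [h, Ideal.mem_bot] at hmem
    exact hp.out.ne_zero (by exact_mod_cast hmem)
  haveI : P.IsMaximal := hP'.1.isMaximal hne
  rw [Ideal.ramificationIdx'_eq_ramificationIdx _ _ span_p_ne_bot, Ideal.inertiaDeg'_eq_inertiaDeg]
  exact hsplit ⟨P, hP'.1, hne⟩ hP'.2

/-- «p splits completely» ⇒ `F` has exactly `[F : ℚ]` embeddings into `ℚ_p`. -/
theorem card_ringHom_eq_finrank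
    (hsplit : ∀ w : HeightOneSpectrum (𝓞 F), w.asIdeal.LiesOver (Ideal.span {(p : ℤ)}) →
      w.asIdeal.ramificationIdx ℤ * w.asIdeal.inertiaDeg ℤ = 1) :
    Nat.card (F →+* ℚ_[p]) = Module.finrank ℚ F := by
  rw [card_ringHom_eq_ncard_primesOver F p hsplit, ncard_primesOver_eq_finrank F p hsplit]

end count

section galois

variable (F) (p) [NumberField F] [IsGalois ℚ F]

/-- `F/ℚ` Galois with ONE degree-one prime above `p` ⇒ every prime above `p` has degree one
(row 12's `degree_one_of_isGalois`, in the `HeightOneSpectrum` vocabulary). -/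
theorem forall_degree_one_of_isGalois (w₀ : HeightOneSpectrum (𝓞 F))
    [hw₀ : w₀.asIdeal.LiesOver (Ideal.span {(p : ℤ)})]
    (hdeg₀ : w₀.asIdeal.ramificationIdx ℤ * w₀.asIdeal.inertiaDeg ℤ = 1) :
    ∀ w : HeightOneSpectrum (𝓞 F), w.asIdeal.LiesOver (Ideal.span {(p : ℤ)}) →
      w.asIdeal.ramificationIdx ℤ * w.asIdeal.inertiaDeg ℤ = 1 := by
  intro w hw
  have h₀ : ((p : ℤ) : 𝓞 F) ∈ w₀.asIdeal := by
    rw [Int.cast_natCast]; exact T5DegreeOneQuotient.natCast_mem_of_liesOver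
  have h₁ : ((p : ℤ) : 𝓞 F) ∈ w.asIdeal := by
    rw [Int.cast_natCast]; exact T5DegreeOneQuotient.natCast_mem_of_liesOver
  exact T5SplitsCompletely.degree_one_of_isGalois (K := F) (𝒪 := 𝓞 F)
    (Nat.prime_iff_prime_int.mp hp.out) w₀.asIdeal h₀ hdeg₀ w.asIdeal h₁

/-- `F/ℚ` Galois with one degree-one prime above `p` ⇒ `F` has exactly `[F : ℚ]` embeddings into
`ℚ_p`, in bijection with the primes above `p` (the datum's situation: CHECK-G S0 / §12.2 row P1.5
for the sextic Galois `E` and its cubic subfield `F`). -/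
theorem card_ringHom_eq_finrank_of_isGalois (w₀ : HeightOneSpectrum (𝓞 F))
    [hw₀ : w₀.asIdeal.LiesOver (Ideal.span {(p : ℤ)})]
    (hdeg₀ : w₀.asIdeal.ramificationIdx ℤ * w₀.asIdeal.inertiaDeg ℤ = 1) :
    Nat.card (F →+* ℚ_[p]) = Module.finrank ℚ F :=
  card_ringHom_eq_finrank F p (forall_degree_one_of_isGalois F p w₀ hdeg₀)

end galois

end Summit.Ventures.HodgeRepro2.T5EmbeddingPrimeEquiv
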